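import Mathlib.Analysis.Complex.Polynomial.Basic
import Mathlib.Analysis.CStarAlgebra.Matrix
import Mathlib.Analysis.CStarAlgebra.Spectrum
import Mathlib.LinearAlgebra.Eigenspace.Triangularizable
import Mathlib.LinearAlgebra.Matrix.Charpoly.Eigs
import Mathlib.LinearAlgebra.Matrix.Kronecker
import Mathlib.LinearAlgebra.UnitaryGroup
import HarnessLib

/-!
# Eigenvalues of a Kronecker product are products of eigenvalues

Topic `Literature/Analysis/InnerProduct`; support file (all proved; no definitions; no named facts).

For square matrices `A` (on `m`) and `B` (on `p`) over an algebraically closed field, every root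
`λ` of the characteristic polynomial of the Kronecker product `A ⊗ₖ B` (Mathlib
`Matrix.kroneckerMap (· * ·)`, scoped notation `⊗ₖ`) is a product `λ = α β` of a root `α` of `χ_A`
and a root `β` of `χ_B`.  Stated with the ROOT MULTISETS of the characteristic polynomials
(`(Matrix.charpoly _).roots`), which over a field are exactly the eigenvalues
(`Matrix.mem_spectrum_iff_isRoot_charpoly`); no hypothesis on `A` or `B` (normality is not needed).

* `exists_mulVec_eq_smul_of_mem_roots_charpoly`, `mem_roots_charpoly_of_mulVec_eq_smul` — roots of
  `χ_M` ↔ eigenvalues with a non-zero eigenvector `M v = c • v` (via `det (c - M) = 0`).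
* `kronecker_one_mulVec_apply`, `one_kronecker_mulVec_apply` — the factors `A ⊗ₖ 1` and `1 ⊗ₖ B`
  act column-wise by `A` and row-wise by `B` on `w : m × p → R`.
* `exists_roots_mul_eq_of_mem_roots_charpoly_kronecker` — the main statement.  Proof: the
  `λ`-eigenspace `S ≠ 0` of `A ⊗ₖ B` is stable under the commuting factor `A ⊗ₖ 1`, which therefore
  has an eigenvector `w ∈ S`, `(A ⊗ₖ 1) w = α w` (`Module.End.exists_eigenvalue` on the
  restriction);
  a non-zero column of `w` is an `α`-eigenvector of `A`, and since
  `A ⊗ₖ B = (1 ⊗ₖ B)(A ⊗ₖ 1)` every row `r` of `w` satisfies `α • B r = λ • r`; a non-zero row gives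
  `β = λ/α ∈ roots χ_B` (or `λ = 0 = α` and any `β`).
* `norm_eq_one_of_mem_roots_charpoly_of_mem_unitaryGroup` — eigenvalues of a unitary matrix have
  norm `1` (Mathlib `spectrum.norm_eq_one_of_unitary` for the C⋆-algebra `Matrix n n ℂ` with the
  `ℓ²` operator norm, scoped `Matrix.Norms.L2Operator`).
* `exists_roots_mul_eq_of_mem_roots_charpoly_kronecker_of_mem_unitaryGroup` (`α ≠ 0`) and
  `exists_roots_norm_sub_conj_eq_of_mem_roots_charpoly_kronecker` (`‖α‖ = 1`, `λ = α β`,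
  `‖β − conj α‖ = ‖λ − 1‖`) — the unitary left factor versions: an eigenvalue of `R ⊗ₖ U` near `1`
  forces an eigenvalue of `U` near a conjugate eigenvalue of the unitary `R`.

Used by the QuantumFields/QCD line `corner-decorrelation-deep-hole` ("a bad site forces a resonant
plaquette", `V = R(α) ⊗ₖ U_P`).  Horn–Johnson, *Topics in Matrix Analysis*, Thm. 4.2.12
(`σ(A ⊗ B) = σ(A) σ(B)`); the common-eigenvector argument for commuting operators is textbook
(Humphreys, GTM 9, §4.1).  Everything here is folklore.  Deliberately NOT here: the full multiset
identity `roots χ_{A ⊗ B} = {α β}` with multiplicities (Newton's identities / triangularisation).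
-/

noncomputable section

namespace Literature.Analysis.InnerProduct

open scoped Kronecker Matrix

/-! ## Roots of the characteristic polynomial and eigenvectors -/

section Field

variable {K : Type*} [Field K] {n : Type*} [Fintype n] [DecidableEq n]

/-- A root `c` of the characteristic polynomial of a square matrix `M` over a field has a non-zero
eigenvector: `M v = c • v`, `v ≠ 0` (because `det (c·1 − M) = χ_M(c) = 0`; root-multiset form of
the tree's `matrix_exists_mulVec_eq_smul_of_isRoot_charpoly` in `SchurInequality`). [folklore] -/
theorem exists_mulVec_eq_smul_of_mem_roots_charpoly {M : Matrix n n K} {c : K}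
    (hc : c ∈ M.charpoly.roots) : ∃ v : n → K, v ≠ 0 ∧ M *ᵥ v = c • v := by
  have hroot : M.charpoly.IsRoot c := (Polynomial.mem_roots M.charpoly_monic.ne_zero).mp hc
  have hdet : (Matrix.scalar n c - M).det = 0 := by
    rw [← Matrix.eval_charpoly]
    exact hroot
  obtain ⟨u, hu, hu0⟩ := Matrix.exists_mulVec_eq_zero_iff.mpr hdet
  refine ⟨u, hu, ?_⟩
  rw [Matrix.sub_mulVec, sub_eq_zero, Matrix.scalar_apply, ← Matrix.smul_one_eq_diagonal,
    Matrix.smul_mulVec, Matrix.one_mulVec] at hu0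
  exact hu0.symm

/-- Conversely, if `M v = c • v` for some non-zero vector `v`, then `c` is a root of the
characteristic polynomial of the square matrix `M` (over a field). [folklore] -/
theorem mem_roots_charpoly_of_mulVec_eq_smul {M : Matrix n n K} {c : K} {v : n → K} (hv : v ≠ 0)
    (h : M *ᵥ v = c • v) : c ∈ M.charpoly.roots := by
  rw [Polynomial.mem_roots M.charpoly_monic.ne_zero, Polynomial.IsRoot.def, Matrix.eval_charpoly]
  refine Matrix.exists_mulVec_eq_zero_iff.mp ⟨v, hv, ?_⟩
  rw [Matrix.sub_mulVec, sub_eq_zero, Matrix.scalar_apply, ← Matrix.smul_one_eq_diagonal,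
    Matrix.smul_mulVec, Matrix.one_mulVec, h]

/-- Over an algebraically closed field the characteristic polynomial of a matrix on a non-empty
index type has a root (its root multiset has `card n ≥ 1` elements). [folklore] -/
theorem exists_mem_roots_charpoly [IsAlgClosed K] [Nonempty n] (M : Matrix n n K) :
    ∃ c, c ∈ M.charpoly.roots := by
  have hsplit : M.charpoly.Splits := IsAlgClosed.splits _
  have hcard : Multiset.card M.charpoly.roots = Fintype.card n := by
    rw [← hsplit.natDegree_eq_card_roots, Matrix.charpoly_natDegree_eq_dim]
  refine Multiset.exists_mem_of_ne_zero fun h0 => ?_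
  rw [h0, Multiset.card_zero] at hcard
  exact Fintype.card_ne_zero hcard.symm

end Field

/-! ## The two commuting factors `A ⊗ₖ 1` and `1 ⊗ₖ B` -/

section Kronecker

variable {R : Type*} [CommSemiring R] {m p : Type*} [Fintype m] [Fintype p]

/-- `A ⊗ₖ 1` acts on `w : m × p → R` column by column through `A`:
`((A ⊗ₖ 1) w)(i, k) = (A w(·, k))(i)`. [folklore] -/
theorem kronecker_one_mulVec_apply [DecidableEq p] (A : Matrix m m R) (w : m × p → R) (i : m)
    (k : p) :
    ((A ⊗ₖ (1 : Matrix p p R)) *ᵥ w) (i, k) = (A *ᵥ fun j => w (j, k)) i := by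
  simp only [Matrix.mulVec, dotProduct, Fintype.sum_prod_type, Matrix.kroneckerMap_apply,
    Matrix.one_apply, mul_ite, mul_one, mul_zero, ite_mul, zero_mul, Finset.sum_ite_eq,
    Finset.mem_univ, if_true]

/-- `1 ⊗ₖ B` acts on `w : m × p → R` row by row through `B`:
`((1 ⊗ₖ B) w)(i, k) = (B w(i, ·))(k)`. [folklore] -/
theorem one_kronecker_mulVec_apply [DecidableEq m] (B : Matrix p p R) (w : m × p → R) (i : m)
    (k : p) :
    (((1 : Matrix m m R) ⊗ₖ B) *ᵥ w) (i, k) = (B *ᵥ fun l => w (i, l)) k := by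
  simp only [Matrix.mulVec, dotProduct, Fintype.sum_prod_type_right, Matrix.kroneckerMap_apply,
    Matrix.one_apply, ite_mul, one_mul, zero_mul, Finset.sum_ite_eq, Finset.mem_univ, if_true]

end Kronecker

/-! ## Eigenvalues of `A ⊗ₖ B` -/

section Main

variable {K : Type*} [Field K] [IsAlgClosed K] {m p : Type*} [Fintype m] [DecidableEq m]
  [Fintype p] [DecidableEq p]

/-- **Eigenvalues of a Kronecker product are products of eigenvalues.**  For square matrices `A`,
`B` over an algebraically closed field, every root `λ` of the characteristic polynomial of `A ⊗ₖ B`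
is `λ = α β` for some root `α` of `χ_A` and some root `β` of `χ_B` (no normality or
diagonalisability hypothesis; Horn–Johnson, *Topics in Matrix Analysis*, Thm. 4.2.12).  Proof: a
common eigenvector of the commuting pair `A ⊗ₖ B`, `A ⊗ₖ 1` inside the `λ`-eigenspace, then a
non-zero column / row of it. [folklore] -/
theorem exists_roots_mul_eq_of_mem_roots_charpoly_kronecker (A : Matrix m m K) (B : Matrix p p K)
    {lam : K} (hlam : lam ∈ (A ⊗ₖ B).charpoly.roots) :
    ∃ α ∈ A.charpoly.roots, ∃ β ∈ B.charpoly.roots, lam = α * β := by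
  -- an eigenvector `v` of `A ⊗ B`
  obtain ⟨v, hv, hABv⟩ := exists_mulVec_eq_smul_of_mem_roots_charpoly hlam
  -- the two commuting endomorphisms
  set f : Module.End K (m × p → K) := Matrix.toLin' (A ⊗ₖ B) with hf
  set g : Module.End K (m × p → K) := Matrix.toLin' (A ⊗ₖ (1 : Matrix p p K)) with hg
  have hmat : (A ⊗ₖ B) * (A ⊗ₖ (1 : Matrix p p K)) = (A ⊗ₖ (1 : Matrix p p K)) * (A ⊗ₖ B) := by
    rw [← Matrix.mul_kronecker_mul, ← Matrix.mul_kronecker_mul, Matrix.mul_one, Matrix.one_mul]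
  -- the `lam`-eigenspace of `f` is non-zero and `g`-stable
  have hvS : v ∈ f.eigenspace lam := by
    rw [Module.End.mem_eigenspace_iff, hf, Matrix.toLin'_apply, hABv]
  have hmaps : ∀ x ∈ f.eigenspace lam, g x ∈ f.eigenspace lam := by
    intro x hx
    rw [Module.End.mem_eigenspace_iff] at hx ⊢
    rw [hf, Matrix.toLin'_apply] at hx
    rw [hf, hg, Matrix.toLin'_apply, Matrix.toLin'_apply, Matrix.mulVec_mulVec, hmat,
      ← Matrix.mulVec_mulVec, hx, Matrix.mulVec_smul]
  haveI : Nontrivial (f.eigenspace lam) :=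
    nontrivial_of_ne ⟨v, hvS⟩ 0 fun h => hv ((Submodule.mk_eq_zero _ _).mp h)
  -- a `g`-eigenvector inside the eigenspace
  obtain ⟨α, hα⟩ := Module.End.exists_eigenvalue (g.restrict hmaps)
  obtain ⟨⟨w, hwS⟩, hw⟩ := hα.exists_hasEigenvector
  have hw0 : w ≠ 0 := fun h =>
    (Module.End.hasEigenvector_iff.mp hw).2 ((Submodule.mk_eq_zero _ _).mpr h)
  have hgw : (A ⊗ₖ (1 : Matrix p p K)) *ᵥ w = α • w := by
    have h := congrArg Subtype.val hw.apply_eq_smul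
    rw [LinearMap.coe_restrict_apply, Submodule.coe_smul, hg, Matrix.toLin'_apply] at h
    exact h
  have hfw : (A ⊗ₖ B) *ᵥ w = lam • w := by
    have h := Module.End.mem_eigenspace_iff.mp hwS
    rwa [hf, Matrix.toLin'_apply] at h
  -- a non-zero entry `w (i₀, k₀)`
  obtain ⟨⟨i₀, k₀⟩, hik⟩ := Function.ne_iff.mp hw0
  -- the column `k₀` of `w` is an `α`-eigenvector of `A`
  have hαA : α ∈ A.charpoly.roots := by
    refine mem_roots_charpoly_of_mulVec_eq_smul (v := fun j => w (j, k₀))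
      (fun h => hik (congrFun h i₀)) ?_
    funext i
    rw [← kronecker_one_mulVec_apply A w i k₀, hgw]
    rfl
  -- `(A ⊗ B) w = (1 ⊗ B) (A ⊗ 1) w = α • (1 ⊗ B) w`
  have hmat2 : A ⊗ₖ B = ((1 : Matrix m m K) ⊗ₖ B) * (A ⊗ₖ (1 : Matrix p p K)) := by
    rw [← Matrix.mul_kronecker_mul, Matrix.one_mul, Matrix.mul_one]
  have hfactor : (A ⊗ₖ B) *ᵥ w = α • (((1 : Matrix m m K) ⊗ₖ B) *ᵥ w) := by
    rw [hmat2, ← Matrix.mulVec_mulVec, hgw, Matrix.mulVec_smul]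
  -- every row `r` of `w` satisfies `α • B r = lam • r`; take the non-zero row `i₀`
  have hrow : α • (B *ᵥ fun l => w (i₀, l)) = lam • fun l => w (i₀, l) := by
    funext k
    have h1 := congrFun (hfactor.symm.trans hfw) (i₀, k)
    rw [Pi.smul_apply, one_kronecker_mulVec_apply, Pi.smul_apply] at h1
    exact h1
  have hr0 : (fun l => w (i₀, l)) ≠ 0 := fun h => hik (congrFun h k₀)
  by_cases hα0 : α = 0
  · -- then `lam = 0`, and any root `β` of `χ_B` (which exists: `p` is non-empty) will do
    have hlam0 : lam = 0 := by
      have h1 := congrFun hrow k₀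
      rw [hα0, zero_smul, Pi.zero_apply, Pi.smul_apply, smul_eq_mul] at h1
      rcases mul_eq_zero.mp h1.symm with h | h
      · exact h
      · exact absurd h hik
    haveI : Nonempty p := ⟨k₀⟩
    obtain ⟨β, hβ⟩ := exists_mem_roots_charpoly B
    exact ⟨α, hαA, β, hβ, by rw [hlam0, hα0, zero_mul]⟩
  · refine ⟨α, hαA, α⁻¹ * lam, ?_, (mul_inv_cancel_left₀ hα0 lam).symm⟩
    refine mem_roots_charpoly_of_mulVec_eq_smul hr0 ?_
    rw [mul_smul, ← hrow, smul_smul, inv_mul_cancel₀ hα0, one_smul]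

end Main

/-! ## Unitary left factor -/

section Unitary

variable {m p : Type*} [Fintype m] [DecidableEq m] [Fintype p] [DecidableEq p]

open scoped Matrix.Norms.L2Operator in
/-- The eigenvalues of a unitary matrix lie on the unit circle: every root `z` of the characteristic
polynomial of `A ∈ U(m)` has `‖z‖ = 1` (Mathlib's `spectrum.norm_eq_one_of_unitary` in the
C⋆-algebra `Matrix m m ℂ` with the `ℓ²` operator norm). [folklore] -/
theorem norm_eq_one_of_mem_roots_charpoly_of_mem_unitaryGroup {A : Matrix m m ℂ}
    (hA : A ∈ Matrix.unitaryGroup m ℂ) {z : ℂ} (hz : z ∈ A.charpoly.roots) : ‖z‖ = 1 := by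
  have hz' : z ∈ spectrum ℂ A := by
    rw [Matrix.mem_spectrum_iff_isRoot_charpoly]
    exact (Polynomial.mem_roots A.charpoly_monic.ne_zero).mp hz
  exact spectrum.norm_eq_one_of_unitary hA hz'

/-- **Eigenvalues of `A ⊗ₖ B` for unitary `A`.**  If `A` is a unitary matrix, every root `λ` of the
characteristic polynomial of `A ⊗ₖ B` is `λ = α β` with `α` a NON-ZERO root of `χ_A` and `β` a root
of `χ_B`. [folklore] -/
theorem exists_roots_mul_eq_of_mem_roots_charpoly_kronecker_of_mem_unitaryGroup {A : Matrix m m ℂ}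
    (hA : A ∈ Matrix.unitaryGroup m ℂ) (B : Matrix p p ℂ) {lam : ℂ}
    (hlam : lam ∈ (A ⊗ₖ B).charpoly.roots) :
    ∃ α ∈ A.charpoly.roots, ∃ β ∈ B.charpoly.roots, α ≠ 0 ∧ lam = α * β := by
  obtain ⟨α, hα, β, hβ, h⟩ := exists_roots_mul_eq_of_mem_roots_charpoly_kronecker A B hlam
  refine ⟨α, hα, β, hβ, ?_, h⟩
  rw [← norm_ne_zero_iff, norm_eq_one_of_mem_roots_charpoly_of_mem_unitaryGroup hA hα]
  exact one_ne_zero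

/-- **An eigenvalue of `R ⊗ₖ U` near `1` forces an eigenvalue of `U` near a conjugate eigenvalue of
the unitary `R`.**  For unitary `A` and any `B`, every root `λ` of `χ_{A ⊗ₖ B}` is `λ = α β` with
`α ∈ roots χ_A`, `‖α‖ = 1`, `β ∈ roots χ_B`, and then `‖β − conj α‖ = ‖λ − 1‖`
(since `β − conj α = conj α · (λ − 1)`). [folklore] -/
theorem exists_roots_norm_sub_conj_eq_of_mem_roots_charpoly_kronecker {A : Matrix m m ℂ}
    (hA : A ∈ Matrix.unitaryGroup m ℂ) (B : Matrix p p ℂ) {lam : ℂ}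
    (hlam : lam ∈ (A ⊗ₖ B).charpoly.roots) :
    ∃ α ∈ A.charpoly.roots, ∃ β ∈ B.charpoly.roots,
      ‖α‖ = 1 ∧ lam = α * β ∧ ‖β - (starRingEnd ℂ) α‖ = ‖lam - 1‖ := by
  obtain ⟨α, hα, β, hβ, h⟩ := exists_roots_mul_eq_of_mem_roots_charpoly_kronecker A B hlam
  have hnorm : ‖α‖ = 1 := norm_eq_one_of_mem_roots_charpoly_of_mem_unitaryGroup hA hα
  refine ⟨α, hα, β, hβ, hnorm, h, ?_⟩
  have hαα : α * (starRingEnd ℂ) α = 1 := by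
    rw [Complex.mul_conj, Complex.normSq_eq_norm_sq, hnorm, one_pow, Complex.ofReal_one]
  calc ‖β - (starRingEnd ℂ) α‖ = ‖α‖ * ‖β - (starRingEnd ℂ) α‖ := by rw [hnorm, one_mul]
    _ = ‖α * (β - (starRingEnd ℂ) α)‖ := (norm_mul _ _).symm
    _ = ‖lam - 1‖ := by rw [mul_sub, hαα, ← h]

end Unitary

end Literature.Analysis.InnerProduct

end
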